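import Summits.BirchSwinnertonDyer.BirchSwinnertonDyer.Theorems.SylvesterTwoHeegnerIndexTwoInertParity
import Summits.BirchSwinnertonDyer.BirchSwinnertonDyer.Theses.SylvesterTwoHeegnerIndex
import Literature.NumberTheory.EllipticCurves.HuShuYin2019.SylvesterThreePart
import Literature.NumberTheory.EllipticCurves.QuadraticTwistRank
import Literature.NumberTheory.EllipticCurves.MordellWeilTheoremProofs
import Literature.NumberTheory.QuadraticFields.SquareRootGenerator
import HarnessLib

/-!
# Route `SylvesterTwoHeegnerIndex` (rung K7t), item 19580 `TwoAdicPairHSY`: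
# the PARITY ENGINE over a quadratic field `K ∋ ω` (transport, `K`-line, `ℚ(ζ₃)`)

HONEST FRAMING (cell b2b-bsdres, seat x1b GEN 48 = O12 class lead; `--supports
stmt-BirchSwinnertonDyer-19580`). Sequel of `…CMNormForm.lean` / `…TwoInertParity.lean`. Item 19580
(`ord₂(#Ш_an(E_p)·#Ш_an(E_{3p²})) = 2n`, `n : ℕ`) is OPEN and STAYS OPEN here. This file is FACT-FREE
(no named fact, no definition): it is the engine that the cited display (bsd) of Hu–Shu–Yin will be
fed into (sequel `…TwoAdicPairOfHeightDisplay.lean`, once the Literature fact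
`HuShuYin2019.shaAnPair_mul_height_eq_two_zpow_mul_height` lands):

* `canonicalHeight_congrEquiv`, `canonicalHeight_pointEquivBaseChange` — `ĥ` is invariant under the
  transport `B(K) ≃+ (C • B)(K)` of a change of variables defined over `ℚ` (tree
  `canonicalHeight_pointEquiv`);
* **`exists_zsmul_eq_of_finrank_eq_two`** — THE `K`-LINE: on a Mordell equation over a number field
  `K ∋ ω` with `rank_ℤ E(K) = 2` (Mordell–Weil = tree `module_finite_point_holds`) and `P` non-torsion,
  every `Y` satisfies `n•Y = a•P + b•[ω]P` with `n ≠ 0` (three points in rank two are dependent;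
  `P, [ω]P` are independent by the norm form);
* `sq_add_self_add_one_eq_zero_of_isPrimitiveRoot`, `finrank_cyclotomicField_three`,
  `two_mul_omega_add_one_sq`, `two_mul_omega_add_one_not_mem_range` — `K = ℚ(ζ₃)`: `ω = ζ₃`,
  `[K:ℚ] = 2`, `√−3 = 2ζ₃ + 1 ∉ ℚ`;
* **`even_padicValRat_two_of_model`** — THE PARITY ENGINE: `K/ℚ` quadratic with `ω ∈ K`, `B` a model of
  `y² = x³ − 432n₀²`, `rank_ℤ B(K) = 2`, `P ∈ B(K)` non-torsion, `q ≠ 0` rational with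
  `q·ĥ_K(P) = 2^i·ĥ_K(Y)`, `i` even ⇒ `ord₂ q` EVEN (`2` inert in `ℤ[ω]`).

WHAT THIS IS NOT: not 19580 for any `p`; nothing about `Ш`; nothing booked, no label moves.
References: [HuShuYin2019] pp. 4, 8, 11, 12; [SilvermanAEC2009] III.3.1(b), VIII.9.1, VIII.9.3.
-/

set_option autoImplicit false
-- the Summit-side namespace `Summit.BirchSwinnertonDyer.BirchSwinnertonDyer.…` (summit = problem) is mandated by D-0017
set_option linter.dupNamespace false

noncomputable section

open scoped Classical

open WeierstrassCurve WeierstrassCurve.Affine WeierstrassCurve.Affine.Point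
  Literature.NumberTheory.EllipticCurves Literature.NumberTheory.EllipticCurves.HuShuYin2019
  Literature.NumberTheory.QuadraticFields
  Summit.BirchSwinnertonDyer.BirchSwinnertonDyer.Theses.SylvesterTwoHeegnerIndex

namespace Summit.BirchSwinnertonDyer.BirchSwinnertonDyer.Theorems.SylvesterTwoCMNormForm

/-! ## §5 Transport lemmas (heights and torsion under `pointEquivBaseChange`) -/

section Transport

variable {K : Type*} [Field K] [NumberField K]

/-- Transport along an equality of equations preserves the canonical height. [folklore] -/
theorem canonicalHeight_congrEquiv {W₁ W₂ : WeierstrassCurve K} (h : W₁ = W₂)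
    (P : W₁.toAffine.Point) : canonicalHeight (Affine.Point.congrEquiv h P) = canonicalHeight P := by
  subst h
  rfl

/-- `ĥ` is invariant under the isomorphism `W(K) ≃+ (C • W)(K)` of a change of variables defined
over `ℚ` (tree `canonicalHeight_pointEquiv`, Silverman *AEC* VIII.9.1 / III.3.1(b)).
[cite: SilvermanAEC2009, Prop. VIII.9.1] -/
theorem canonicalHeight_pointEquivBaseChange (W : WeierstrassCurve ℚ) (C : VariableChange ℚ)
    (P : (W.baseChange K).toAffine.Point) :
    canonicalHeight (VariableChange.pointEquivBaseChange W C K P) = canonicalHeight P := by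
  rw [VariableChange.pointEquivBaseChange, AddEquiv.trans_apply, canonicalHeight_congrEquiv,
    canonicalHeight_pointEquiv]

end Transport

/-! ## §6 The `K`-line: `rank_ℤ = 2` and the independence of `P, [ω]P` give `nY = aP + b[ω]P` -/

section KLine

variable {K : Type*} [Field K] [NumberField K] {W : WeierstrassCurve K} [W.IsElliptic] {ω : K}
variable (hω : ω ^ 2 + ω + 1 = 0) (h1 : W.a₁ = 0) (h2 : W.a₂ = 0) (h3 : W.a₃ = 0) (h4 : W.a₄ = 0)
variable {θ : W.toAffine.Point → W.toAffine.Point} (hθ0 : θ 0 = 0)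
  (hθ : ∀ (x y : K) (h : W.toAffine.Nonsingular x y),
    θ (.some x y h) = .some (ω * x) y (nonsingular_omega_mul hω h1 h2 h3 h4 h))

include hω h1 h2 h3 h4 hθ0 hθ

/-- **The `K`-line.** On a Mordell equation over a number field `K ∋ ω` with `rank_ℤ E(K) = 2`
(Mordell–Weil: `E(K)` is finitely generated, tree `module_finite_point_holds`), for `P` non-torsion
every `Y ∈ E(K)` satisfies `n•Y = a•P + b•[ω]P` for some `n ≠ 0`: the three points `Y, P, [ω]P` are
`ℤ`-dependent (`3 > 2`), and the coefficient of `Y` cannot vanish because `P, [ω]P` are independent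
(`isOfFinAddOrder_zsmul_add_zsmul_omegaRot_iff`). [cite: HuShuYin2019, p. 8 (`K ⊗_{O_K} E_p(K) ≃ K`)] -/
theorem exists_zsmul_eq_of_finrank_eq_two (hr : Module.finrank ℤ W.toAffine.Point = 2)
    {P : W.toAffine.Point} (hP : ¬IsOfFinAddOrder P) (Y : W.toAffine.Point) :
    ∃ n a b : ℤ, n ≠ 0 ∧ n • Y = a • P + b • θ P + 0 := by
  haveI : Module.Finite ℤ W.toAffine.Point := module_finite_point_holds (W := W)
  have hdep : ¬ LinearIndependent ℤ ![Y, P, θ P] := by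
    intro hli
    have h := hli.fintype_card_le_finrank
    rw [Fintype.card_fin, hr] at h
    omega
  obtain ⟨g, hg, i0, hi0⟩ := Fintype.not_linearIndependent_iff.mp hdep
  rw [Fin.sum_univ_three] at hg
  simp only [Matrix.cons_val_zero, Matrix.cons_val_one, Matrix.cons_val] at hg
  have hg0 : g 0 ≠ 0 := by
    intro h0
    rw [h0, zero_smul, zero_add] at hg
    have hfin : IsOfFinAddOrder (g 1 • P + g 2 • θ P) := by
      rw [hg]
      exact IsOfFinAddOrder.zero
    obtain ⟨h1', h2'⟩ :=
      (isOfFinAddOrder_zsmul_add_zsmul_omegaRot_iff hω h1 h2 h3 h4 hθ0 hθ hP).mp hfin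
    apply hi0
    fin_cases i0
    · exact h0
    · exact h1'
    · exact h2'
  refine ⟨g 0, -g 1, -g 2, hg0, ?_⟩
  rw [add_zero, neg_smul, neg_smul]
  have : g 0 • Y = -(g 1 • P + g 2 • θ P) := by
    rw [eq_neg_iff_add_eq_zero, ← add_assoc]
    exact hg
  rw [this, neg_add]

end KLine

/-! ## §7 `K = ℚ(ζ₃)` and the parity engine -/

section Parity

/-- `ω² + ω + 1 = 0` for a primitive cube root of unity. [folklore] -/
theorem sq_add_self_add_one_eq_zero_of_isPrimitiveRoot {K : Type*} [Field K] {ω : K}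
    (h : IsPrimitiveRoot ω 3) : ω ^ 2 + ω + 1 = 0 := by
  have h3 : ω ^ 3 = 1 := h.pow_eq_one
  have h1 : ω ≠ 1 := h.ne_one (by norm_num)
  have : (ω - 1) * (ω ^ 2 + ω + 1) = 0 := by linear_combination h3
  rcases mul_eq_zero.mp this with h | h
  · exact absurd (sub_eq_zero.mp h) h1
  · exact h

/-- `[ℚ(ζ₃) : ℚ] = 2` (`φ(3) = 2`). [folklore] -/
theorem finrank_cyclotomicField_three : Module.finrank ℚ (CyclotomicField 3 ℚ) = 2 := by
  haveI : IsCyclotomicExtension {3} ℚ (CyclotomicField 3 ℚ) :=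
    CyclotomicField.isCyclotomicExtension 3 ℚ
  rw [IsCyclotomicExtension.finrank (n := 3) (K := ℚ) (CyclotomicField 3 ℚ)
    (Polynomial.cyclotomic.irreducible_rat (by norm_num)), Nat.totient_prime Nat.prime_three]

/-- **The parity over an arbitrary quadratic field `K ∋ ω`** (the engine of `twoAdicPairHSY_parity`):
given a model `B` of `E_{n₀}` (`C • B = (y² = x³ − 432n₀²)`), `rank_ℤ B(K) = 2`, a non-torsion
`P ∈ B(K)`, `Y ∈ B(K)` and a rational `q ≠ 0` with `q·ĥ_K(P) = 2^i·ĥ_K(Y)`, `i` even, the valuation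
`ord₂ q` is even. Transport to the Mordell model (`pointEquivBaseChange`, heights invariant), `[ω]` there
(`exists_omegaRot`), the `K`-line (`exists_zsmul_eq_of_finrank_eq_two`) and the `2`-inertness
assembly (`even_padicValRat_two_of_height_identity`). [cite: HuShuYin2019, display (bsd) p. 12] -/
theorem even_padicValRat_two_of_model {K : Type*} [Field K] [NumberField K] {ω : K}
    (hω : ω ^ 2 + ω + 1 = 0) {n₀ : ℚ} (B : WeierstrassCurve ℚ) [B.IsElliptic]
    (C : VariableChange ℚ) (hC : C • B = cubeSumCurve n₀)
    (hrank : (B.baseChange K).mordellWeilRank = 2) {PK : (B.baseChange K).toAffine.Point}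
    (hP : ¬IsOfFinAddOrder PK) (Y : (B.baseChange K).toAffine.Point) {q : ℚ} (hq : q ≠ 0) {i : ℤ}
    (hi : Even i) (hid : (q : ℝ) * canonicalHeight PK = (2 : ℝ) ^ i * canonicalHeight Y) :
    Even (padicValRat 2 q) := by
  -- Hu–Shu–Yin's model `W' = (y² = x³ − 432n₀²)` over `K`
  have hCK : (C • B).baseChange K = (cubeSumCurve n₀).baseChange K := by rw [hC]
  have ha1 : ((cubeSumCurve n₀).baseChange K).a₁ = 0 := by
    simp [cubeSumCurve, WeierstrassCurve.baseChange]
  have ha2 : ((cubeSumCurve n₀).baseChange K).a₂ = 0 := by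
    simp [cubeSumCurve, WeierstrassCurve.baseChange]
  have ha3 : ((cubeSumCurve n₀).baseChange K).a₃ = 0 := by
    simp [cubeSumCurve, WeierstrassCurve.baseChange]
  have ha4 : ((cubeSumCurve n₀).baseChange K).a₄ = 0 := by
    simp [cubeSumCurve, WeierstrassCurve.baseChange]
  haveI hBK : (B.baseChange K).IsElliptic := inferInstanceAs (B.map (algebraMap ℚ K)).IsElliptic
  haveI hE : (cubeSumCurve n₀).IsElliptic := hC ▸ (inferInstance : (C • B).IsElliptic)
  haveI hEK : ((cubeSumCurve n₀).baseChange K).IsElliptic :=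
    inferInstanceAs ((cubeSumCurve n₀).map (algebraMap ℚ K)).IsElliptic
  -- the transport `φ : B(K) ≃+ W'(K)` and its compatibility with heights
  let φ : (B.baseChange K).toAffine.Point ≃+ ((cubeSumCurve n₀).baseChange K).toAffine.Point :=
    (VariableChange.pointEquivBaseChange B C K).trans (Affine.Point.congrEquiv hCK)
  have hφ : ∀ X, canonicalHeight (φ X) = canonicalHeight X := fun X => by
    show canonicalHeight (Affine.Point.congrEquiv hCK (VariableChange.pointEquivBaseChange B C K X)) =
      canonicalHeight X
    rw [canonicalHeight_congrEquiv, canonicalHeight_pointEquivBaseChange]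
  -- `[ω]` on `W'(K)`
  obtain ⟨θ, hθ⟩ := exists_omegaRot (W := (cubeSumCurve n₀).baseChange K) hω ha1 ha2 ha3 ha4
  have hθ0 : (θ : _ → _) 0 = 0 := map_zero θ
  -- the image of `P` is non-torsion
  have hP' : ¬IsOfFinAddOrder (φ PK) := fun h =>
    hP ((φ.injective.isOfFinAddOrder_iff (f := φ.toAddMonoidHom)).mp h)
  -- `rank_ℤ W'(K) = 2`
  have hr : Module.finrank ℤ ((cubeSumCurve n₀).baseChange K).toAffine.Point = 2 := by
    rw [← φ.toIntLinearEquiv.finrank_eq]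
    exact hrank
  obtain ⟨n, a, b, hn, hY'⟩ :=
    exists_zsmul_eq_of_finrank_eq_two hω ha1 ha2 ha3 ha4 hθ0 hθ hr hP' (φ Y)
  -- the height identity on `W'`
  have hid' : (q : ℝ) * canonicalHeight (φ PK) = (2 : ℝ) ^ i * canonicalHeight (φ Y) := by
    rw [hφ, hφ]
    exact hid
  exact even_padicValRat_two_of_height_identity hω ha1 ha2 ha3 ha4 hθ0 hθ hP'
    IsOfFinAddOrder.zero hn hY' hq hi hid'

end Parity

/-! ## §7b `√−3 = 2ζ₃ + 1` -/

section SqrtMinusThree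


/-- `√−3 = 2ζ₃ + 1`: `(2ω + 1)² = −3` for `ω² + ω + 1 = 0`. [folklore] -/
theorem two_mul_omega_add_one_sq {K : Type*} [Field K] {ω : K} (hω : ω ^ 2 + ω + 1 = 0) :
    (2 * ω + 1) ^ 2 = -3 := by
  linear_combination 4 * hω

/-- `2ζ₃ + 1 ∉ ℚ` inside any field of characteristic `0` containing `ζ₃` (its square is `−3 < 0`).
[folklore] -/
theorem two_mul_omega_add_one_not_mem_range {K : Type*} [Field K] [CharZero K] {ω : K}
    (hω : ω ^ 2 + ω + 1 = 0) : 2 * ω + 1 ∉ Set.range (algebraMap ℚ K) := by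
  rintro ⟨r, hr⟩
  have h := two_mul_omega_add_one_sq hω
  rw [← hr, ← map_pow] at h
  have h' : (algebraMap ℚ K) (r ^ 2) = algebraMap ℚ K (-3) := by rw [h]; simp
  have hr2 : r ^ 2 = -3 := (algebraMap ℚ K).injective h'
  nlinarith [sq_nonneg r]


end SqrtMinusThree

end Summit.BirchSwinnertonDyer.BirchSwinnertonDyer.Theorems.SylvesterTwoCMNormForm

end
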